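import Literature.NumberTheory.Rogawski1990.LocalNormFibreNonsplit                      -- ★ `charpoly_endoEmbLocal`, `IsLocalNormPair.charpoly_eq`, `IsLocalGRegular.separable_mul` (norm pairs share the characteristic polynomial)
import Literature.NumberTheory.Rogawski1990.LocalStableClassesNonsplitTypeOneOfCharpoly   -- ★ `exists_eigenframe_of_charpoly_eq_prod` (distinct eigenvalues ⇒ eigenframe, [HornJohnson 3.3.P12])
import Literature.NumberTheory.Rogawski1990.ExplicitFactorKappaAlmostEverywhereOne        -- ★ `conjLocal_finGammaTwo_mul_finGammaTwo` (the `U(Φ₁)`-slot is norm one)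
import Literature.NumberTheory.Rogawski1990.CMLocalAPacketMembers                          -- ★ `Gqs`, `qsForm` (the (E8)∕F carriers)
import Literature.NumberTheory.Automorphic.UnitaryGroupNonsplitPlace                       -- ★ `UnitaryGroup.LocalRing.isField_of_smul_eq` (`E_v` is a field at a non-split `v`)
import Mathlib.Topology.Algebra.ContinuousMonoidHom
import HarnessLib

/-!
# F0 · P3 — ROAD «ELL-INNER» (map owner LH6-p03 (g7)), brick (E4″) «FRAME DISCHARGE»: the type-(1) eigenframe binder `hframe` of ★ (E4′)
# `F0P3cStCharTSEllInnerCrossIndexed.sum_finKappaAt_mul_finKappaAt_eq_zero` from the (E2b) slot clauses (D) and (R)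

Cell `pub/hodgecm-mathlib`, crux H413 = `stmt-HodgeConjecture-24833` (lane `--supports … --as helper`), route HCCMUnconditional; seat LH6-p04 (g8) (the `hframe`
letter is this lineage's: ★ p852638, LH6-p04 (g7)).  THEOREMS ONLY (no definition ∕ instance ∕ notation ∕ named fact ∕ `sorry`); ★-only imports.

WHAT.  ★ (E4′) `sum_finKappaAt_mul_finKappaAt_eq_zero` (the (E8) binder `hcross`) keeps ONE by-shape binder, the FRAME
```
hframe : ∀ T ∈ SH, ∀ (s : ↥T), IsLocalGRegular L v ↑s → ∀ u u' : Fin (cQ T), u ≠ u' →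
  ∃ (i₀ : Fin (n T)) (P : GL (Fin 3) E_v) (d : Fin 3 → E_v) (j j' : Fin 3),
    ↑(eT T i₀ s) * P = P * diagonal d ∧ Function.Injective d ∧ (∀ k, σ̄ (d k) * d k = 1) ∧
    d j = finGammaTwo (σ T u s).1 ∧ d j' = finGammaTwo (σ T u' s).1 ∧ j ≠ j'
```
(a `G`-partner `b = e_{i₀} s` of `s`, an eigenframe of `b` in `GL₃(E_v)` with pairwise distinct norm-one eigenvalues, two of whose slots carry the `U(Φ₁)`-entries of the
slots `σ_u s ≠ σ_{u′} s`).  This file DISCHARGES it — `hframe_of_slotClauses` — from the letters the F ∕ (E8) assembly already holds: the ★ (X2)∕(E8) embedding letters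
`heT` (every `e_i s` is a norm partner of `s`) and `hexh` (every partner of a `G`-regular `s` is conjugate to some `e_i s`), and two clauses of the (E2b) ∃-package
`exists_slotMaps` (F0P3a-p03 (g27), CENSUS-E2b-SlotAut v1 §1) in the letters ★ (E2) `F0P3cStCharTSEllInnerFibreEnum.hcQ_of_slotClauses'` consumed VERBATIM:
(D) `u ≠ u′ ⇒ finGammaTwo (σ T u s).1 ≠ finGammaTwo (σ T u′ s).1` and (R) `(charpoly ι_v(s)).IsRoot r ↔ ∃ u, finGammaTwo (σ T u s).1 = r`.
So the F ∕ (E8) call reads `hframe := hframe_of_slotClauses L v hns SH n γc eT heT hexh cQ σ hD hR` — no new letter.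

THE MATHEMATICS (folklore linear algebra at a non-split place; [Rogawski1990, §3.6 p. 31, §5.4 p. 78] for context).  Fix `T ∈ SH`, a `G`-regular `s ∈ T` and slots
`u ≠ u′`.  (1) `s` HAS a `G`-partner — `ι_v(s)` itself (`IsLocalNormPair` is conjugacy of `ι_v(s)` with the partner in `GL₃(E_v)`, reflexive) — so `hexh` yields an index
`i₀`, and `b := e_{i₀} s` is a partner of `s` (`heT`), whence `charpoly b = charpoly ι_v(s) =: p` (★ `IsLocalNormPair.charpoly_eq`, ★ `charpoly_endoEmbLocal`), a MONIC
CUBIC, SEPARABLE because `s` is `G`-regular (★ `IsLocalGRegular.separable_mul`).  (2) By (R) the `U(Φ₁)`-entries `r₁ := γ₂(σ_u s)`, `r₂ := γ₂(σ_{u′} s)` are roots of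
`p`, DISTINCT by (D).  At a non-split `v`, `E_v = ∏_{w ∣ v} L_w` is a field (★ `UnitaryGroup.LocalRing.isField_of_smul_eq`), so `r₂ − r₁` is a unit and monic division
peels both roots: `p = (X − r₁)(X − r₂)(X − r₃)` with `r₃ ∈ E_v` (the monic linear cofactor).  (3) `d := (r₁, r₂, r₃)` is injective (a separable product of linear
factors has distinct roots, `Polynomial.Separable.injective_of_prod_X_sub_C`); every `d k` is a root of `p`, hence by (R) the `U(Φ₁)`-entry of some slot, hence of
norm one (★ `conjLocal_finGammaTwo_mul_finGammaTwo`: `U(Φ₁) = E¹`).  (4) A matrix over a field whose characteristic polynomial is `∏ (X − d k)` with `d` injective has an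
eigenframe `b P = P diag(d)` (★ `exists_eigenframe_of_charpoly_eq_prod`, [HornJohnson2013, 3.3.P12]); `j := 0`, `j′ := 1`.  Type (2) tori (`cQ T = 1`) never reach this
statement (`u ≠ u′` is empty there) — exactly as the (E4′) docstring priced it.
HONEST LABEL: count-neutral helper toward the F ∕ (E8) assembly of ROAD «ELL-INNER»; `𝔇.Prop1252` stays a PRINTED consequent of the LH6 organ (S-𝔑) until the road's ★
rider; HC_CM is proved only modulo the 7 printed citations (2 remaining: hLiu418 = `stmt-HodgeConjecture-24832`, h413 = `stmt-HodgeConjecture-24833`) until rung 0 closes.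

## References
* [Rogawski1990] J. D. Rogawski, *Automorphic Representations of Unitary Groups in Three Variables*, Ann. of Math. Stud. 123 (1990): §3.6 p. 31 (the Cartan subgroups of
  type `(E¹)³`: three distinct norm-one eigenvalues), §5.4 p. 78 (the stable classes of `H` over a class are told apart by the `U(1)`-slot), §12.5 Prop. 12.5.2 (proof)
  p. 185 (where the frame is used: «the sum over `δ` is zero unless the characters coincide»).
* [HornJohnson2013] R. A. Horn, C. R. Johnson, *Matrix Analysis* (2nd ed., 2013), 3.3.P12 (same separable characteristic polynomial ⇒ similar; here via ★
  `exists_eigenframe_of_charpoly_eq_prod`).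
-/

set_option autoImplicit false
-- the mandated namespace has the single-problem summit's repeated segment (`HodgeConjecture.HodgeConjecture`)
set_option linter.dupNamespace false

noncomputable section

open NumberField IsDedekindDomain Matrix Polynomial
open Literature.NumberTheory.Automorphic Literature.NumberTheory.Automorphic.UnitaryGroup Literature.NumberTheory.Rogawski1990
open scoped MatrixGroups

namespace Summit.HodgeConjecture.HodgeConjecture.Cruxes.H413.F0P3cStCharTSEllInnerFrameOfSlots

section CM

variable (L : Type) [Field L] [NumberField L] [IsCMField L] (v : HeightOneSpectrum (𝓞 ↥(maximalRealSubfield L)))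

/-! ## §1 A monic cubic with two distinct roots over `E_v` (non-split `v`) is a product of three linear factors -/

/-- **Peeling two distinct roots off a monic cubic over `E_v = ∏_{w ∣ v} L_w` at a NON-SPLIT `v`** (where `E_v` is a field, ★ `UnitaryGroup.LocalRing.isField_of_smul_eq`):
if `p` is monic of degree `3` with roots `r₁ ≠ r₂`, then `p = (X − C r₁) * (X − C r₂) * (X − C r₃)` for some `r₃ ∈ E_v` — monic division by `X − C r₁`
(`Polynomial.mul_divByMonic_eq_iff_isRoot`), the unit `r₂ − r₁` moves the root `r₂` to the quadratic cofactor, and the last cofactor is monic linear.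
[cite: Rogawski1990, §3.6 p. 31] -/
theorem eq_prod_three_of_monic_of_isRoot_of_isRoot (hns : ∀ w : PlacesOver L v, IsCMField.complexConj L • w.1 = w.1)
    {p : Polynomial (UnitaryGroup.LocalRing L v)} (hp : p.Monic) (hdeg : p.natDegree = 3) {r₁ r₂ : UnitaryGroup.LocalRing L v}
    (h₁ : p.IsRoot r₁) (h₂ : p.IsRoot r₂) (hne : r₁ ≠ r₂) :
    ∃ r₃ : UnitaryGroup.LocalRing L v, p = (X - C r₁) * (X - C r₂) * (X - C r₃) := by
  -- `E_v` is a field at the non-split `v`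
  obtain ⟨w⟩ := (inferInstance : Nonempty (PlacesOver L v))
  haveI : Algebra.IsQuadraticExtension ↥(maximalRealSubfield L) L := IsCMField.isQuadraticExtension L
  have hF : IsField (UnitaryGroup.LocalRing L v) :=
    UnitaryGroup.LocalRing.isField_of_smul_eq (IsCMField.complexConj L) (IsCMField.complexConj_ne_one L) w (hns w)
  -- peel `r₁`
  set q₁ : Polynomial (UnitaryGroup.LocalRing L v) := p /ₘ (X - C r₁) with hq₁
  have hpq₁ : (X - C r₁) * q₁ = p := (mul_divByMonic_eq_iff_isRoot).2 h₁
  have hq₁m : q₁.Monic := Monic.of_mul_monic_left (monic_X_sub_C r₁) (by rw [hpq₁]; exact hp)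
  -- `r₂` is a root of the cofactor: `0 = p(r₂) = (r₂ - r₁) · q₁(r₂)` and `r₂ - r₁` is a unit
  have hq₁r : q₁.IsRoot r₂ := by
    have h0 : (r₂ - r₁) * q₁.eval r₂ = 0 := by
      have := h₂
      rw [← hpq₁, IsRoot, eval_mul, eval_sub, eval_X, eval_C] at this
      exact this
    obtain ⟨b, hb⟩ := hF.mul_inv_cancel (sub_ne_zero.2 hne.symm)
    have h1 : q₁.eval r₂ = b * ((r₂ - r₁) * q₁.eval r₂) := by
      rw [← mul_assoc, mul_comm b, hb, one_mul]
    rw [IsRoot, h1, h0, mul_zero]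
  -- peel `r₂`
  set q₂ : Polynomial (UnitaryGroup.LocalRing L v) := q₁ /ₘ (X - C r₂) with hq₂
  have hq₁q₂ : (X - C r₂) * q₂ = q₁ := (mul_divByMonic_eq_iff_isRoot).2 hq₁r
  have hq₂m : q₂.Monic := Monic.of_mul_monic_left (monic_X_sub_C r₂) (by rw [hq₁q₂]; exact hq₁m)
  -- degrees: `q₁` has degree 2, `q₂` degree 1
  have hq₁d : q₁.natDegree = 2 := by
    rw [hq₁, natDegree_divByMonic p (monic_X_sub_C r₁), hdeg, natDegree_X_sub_C]
  have hq₂d : q₂.natDegree = 1 := by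
    rw [hq₂, natDegree_divByMonic q₁ (monic_X_sub_C r₂), hq₁d, natDegree_X_sub_C]
  -- the last cofactor is `X - C r₃`
  refine ⟨-q₂.coeff 0, ?_⟩
  have hq₂e : q₂ = X - C (-q₂.coeff 0) := by
    rw [map_neg, sub_neg_eq_add]
    exact hq₂m.eq_X_add_C hq₂d
  rw [← hpq₁, ← hq₁q₂, ← hq₂e, mul_assoc]

/-! ## §2 The frame -/

/-- **(E4″) «FRAME DISCHARGE» — the (E4′) binder `hframe` from the (E2b) slot clauses (D), (R) and the embedding letters `heT`, `hexh`.**  For `T ∈ SH`, a `G`-regular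
`s ∈ T` and slots `u ≠ u′`: there are an index `i₀`, a frame `P ∈ GL₃(E_v)`, eigenvalues `d : Fin 3 → E_v` and slots `j ≠ j′` with `e_{i₀} s · P = P · diag(d)`, `d` injective,
`σ̄(d k) d k = 1` for all `k`, `d j = γ₂(σ_u s)`, `d j′ = γ₂(σ_{u′} s)`.  Proof: module docstring (1)–(4) — partner `b = e_{i₀} s` via `hexh` at `ι_v(s)`; `charpoly b =
charpoly ι_v(s)` monic separable cubic with the distinct roots `γ₂(σ_u s)`, `γ₂(σ_{u′} s)` ((R), (D)); §1 splits it over the field `E_v`; separability makes the three roots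
distinct, (R) makes them norm one, ★ `exists_eigenframe_of_charpoly_eq_prod` gives the frame.  The conclusion is ★ (E4′)
`F0P3cStCharTSEllInnerCrossIndexed.sum_finKappaAt_mul_finKappaAt_eq_zero`'s `hframe` binder token for token; the hypotheses `heT hexh` are ★ (E8)'s letters and
`hD hR` are ★ (E2) `hcQ_of_slotClauses'`'s letters token for token.
[cite: Rogawski1990, §3.6 p. 31; §5.4 p. 78; §12.5 Prop. 12.5.2 (proof) p. 185] [cite: HornJohnson2013, 3.3.P12] -/
theorem hframe_of_slotClauses (hns : ∀ w : PlacesOver L v, IsCMField.complexConj L • w.1 = w.1)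
    (SH : Finset (Subgroup ((UnitaryGroup.cmDatum L 2 (Matrix.of fun i j : Fin 2 => if i.val + j.val + 1 = 2 then (1 : L) else 0)).Local v × (UnitaryGroup.cmDatum L 1 (Matrix.of fun i j : Fin 1 => if i.val + j.val + 1 = 1 then (1 : L) else 0)).Local v)))
    (n : Subgroup ((UnitaryGroup.cmDatum L 2 (Matrix.of fun i j : Fin 2 => if i.val + j.val + 1 = 2 then (1 : L) else 0)).Local v × (UnitaryGroup.cmDatum L 1 (Matrix.of fun i j : Fin 1 => if i.val + j.val + 1 = 1 then (1 : L) else 0)).Local v) → ℕ)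
    (γc : (T : Subgroup ((UnitaryGroup.cmDatum L 2 (Matrix.of fun i j : Fin 2 => if i.val + j.val + 1 = 2 then (1 : L) else 0)).Local v × (UnitaryGroup.cmDatum L 1 (Matrix.of fun i j : Fin 1 => if i.val + j.val + 1 = 1 then (1 : L) else 0)).Local v)) → Fin (n T) → Gqs L v)
    (eT : (T : Subgroup ((UnitaryGroup.cmDatum L 2 (Matrix.of fun i j : Fin 2 => if i.val + j.val + 1 = 2 then (1 : L) else 0)).Local v × (UnitaryGroup.cmDatum L 1 (Matrix.of fun i j : Fin 1 => if i.val + j.val + 1 = 1 then (1 : L) else 0)).Local v)) → (i : Fin (n T)) → (↥T ≃ₜ* ↥(Subgroup.centralizer ({γc T i} : Set (Gqs L v)))))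
    (heT : ∀ T ∈ SH, ∀ (i : Fin (n T)) (s : ↥T), IsLocalNormPair L (qsForm L) v s.1 ((eT T i s : ↥(Subgroup.centralizer ({γc T i} : Set (Gqs L v)))) : Gqs L v))
    (hexh : ∀ T ∈ SH, ∀ (s : ↥T), IsLocalGRegular L v (s : ((UnitaryGroup.cmDatum L 2 (Matrix.of fun i j : Fin 2 => if i.val + j.val + 1 = 2 then (1 : L) else 0)).Local v × (UnitaryGroup.cmDatum L 1 (Matrix.of fun i j : Fin 1 => if i.val + j.val + 1 = 1 then (1 : L) else 0)).Local v)) →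
      ∀ γ' : Gqs L v, IsLocalNormPair L (qsForm L) v s.1 γ' → ∃ i : Fin (n T), IsConj ((eT T i s : ↥(Subgroup.centralizer ({γc T i} : Set (Gqs L v)))) : Gqs L v) γ')
    (cQ : Subgroup ((UnitaryGroup.cmDatum L 2 (Matrix.of fun i j : Fin 2 => if i.val + j.val + 1 = 2 then (1 : L) else 0)).Local v × (UnitaryGroup.cmDatum L 1 (Matrix.of fun i j : Fin 1 => if i.val + j.val + 1 = 1 then (1 : L) else 0)).Local v) → ℕ) (σ : (T : Subgroup ((UnitaryGroup.cmDatum L 2 (Matrix.of fun i j : Fin 2 => if i.val + j.val + 1 = 2 then (1 : L) else 0)).Local v × (UnitaryGroup.cmDatum L 1 (Matrix.of fun i j : Fin 1 => if i.val + j.val + 1 = 1 then (1 : L) else 0)).Local v)) → Fin (cQ T) → (↥T → ↥T))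
    (hD : ∀ T ∈ SH, ∀ (s : ↥T), IsLocalGRegular L v (s : ((UnitaryGroup.cmDatum L 2 (Matrix.of fun i j : Fin 2 => if i.val + j.val + 1 = 2 then (1 : L) else 0)).Local v × (UnitaryGroup.cmDatum L 1 (Matrix.of fun i j : Fin 1 => if i.val + j.val + 1 = 1 then (1 : L) else 0)).Local v)) → ∀ u u' : Fin (cQ T), u ≠ u' → finGammaTwo L v (σ T u s).1 ≠ finGammaTwo L v (σ T u' s).1)
    (hR : ∀ T ∈ SH, ∀ (s : ↥T), IsLocalGRegular L v (s : ((UnitaryGroup.cmDatum L 2 (Matrix.of fun i j : Fin 2 => if i.val + j.val + 1 = 2 then (1 : L) else 0)).Local v × (UnitaryGroup.cmDatum L 1 (Matrix.of fun i j : Fin 1 => if i.val + j.val + 1 = 1 then (1 : L) else 0)).Local v)) → ∀ r : UnitaryGroup.LocalRing L v,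
      (((endoEmbLocal L v s.1).val.val : Matrix (Fin 3) (Fin 3) (UnitaryGroup.LocalRing L v)).charpoly).IsRoot r ↔ ∃ u : Fin (cQ T), finGammaTwo L v (σ T u s).1 = r) :
    ∀ T ∈ SH, ∀ (s : ↥T), IsLocalGRegular L v (s : ((UnitaryGroup.cmDatum L 2 (Matrix.of fun i j : Fin 2 => if i.val + j.val + 1 = 2 then (1 : L) else 0)).Local v × (UnitaryGroup.cmDatum L 1 (Matrix.of fun i j : Fin 1 => if i.val + j.val + 1 = 1 then (1 : L) else 0)).Local v)) →
      ∀ u u' : Fin (cQ T), u ≠ u' →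
        ∃ (i₀ : Fin (n T)) (P : GL (Fin 3) (UnitaryGroup.LocalRing L v)) (d : Fin 3 → UnitaryGroup.LocalRing L v) (j j' : Fin 3),
          (((eT T i₀ s : ↥(Subgroup.centralizer ({γc T i₀} : Set (Gqs L v)))) : Gqs L v).val.val : Matrix (Fin 3) (Fin 3) (UnitaryGroup.LocalRing L v)) * P.val = P.val * diagonal d ∧
          Function.Injective d ∧ (∀ k, UnitaryGroup.conjLocal L (IsCMField.complexConj L) v (d k) * d k = 1) ∧
          d j = finGammaTwo L v (σ T u s).1 ∧ d j' = finGammaTwo L v (σ T u' s).1 ∧ j ≠ j' := by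
  intro T hT s hs u u' huu'
  -- (1) the partner `ι_v(s)` of `s` gives an index `i₀`; `b := e_{i₀} s` is a partner of `s`
  have hself : IsLocalNormPair L (qsForm L) v s.1 (endoEmbLocal L v s.1) :=
    (isLocalNormPair_iff L (qsForm L) v s.1 _).2 (IsConj.refl _)
  obtain ⟨i₀, -⟩ := hexh T hT s hs (endoEmbLocal L v s.1) hself
  have hb : IsLocalNormPair L (qsForm L) v s.1 ((eT T i₀ s : ↥(Subgroup.centralizer ({γc T i₀} : Set (Gqs L v)))) : Gqs L v) := heT T hT i₀ s
  -- the common characteristic polynomial `p`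
  set p : Polynomial (UnitaryGroup.LocalRing L v) :=
    ((endoEmbLocal L v s.1).val.val : Matrix (Fin 3) (Fin 3) (UnitaryGroup.LocalRing L v)).charpoly with hpdef
  have hpb : (((eT T i₀ s : ↥(Subgroup.centralizer ({γc T i₀} : Set (Gqs L v)))) : Gqs L v).val.val : Matrix (Fin 3) (Fin 3) (UnitaryGroup.LocalRing L v)).charpoly = p := by
    rw [hpdef, charpoly_endoEmbLocal]
    exact hb.charpoly_eq
  -- `E_v` is a field: nontrivial, so `p` is a monic cubic; separable since `s` is `G`-regular
  obtain ⟨w⟩ := (inferInstance : Nonempty (PlacesOver L v))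
  haveI : Algebra.IsQuadraticExtension ↥(maximalRealSubfield L) L := IsCMField.isQuadraticExtension L
  have hF : IsField (UnitaryGroup.LocalRing L v) :=
    UnitaryGroup.LocalRing.isField_of_smul_eq (IsCMField.complexConj L) (IsCMField.complexConj_ne_one L) w (hns w)
  haveI : Nontrivial (UnitaryGroup.LocalRing L v) := hF.nontrivial
  have hpm : p.Monic := Matrix.charpoly_monic _
  have hpdeg : p.natDegree = 3 := by
    rw [hpdef, Matrix.charpoly_natDegree_eq_dim, Fintype.card_fin]
  have hpsep : p.Separable := by
    rw [hpdef, charpoly_endoEmbLocal]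
    exact hs.separable_mul
  -- (2) the two slot entries are distinct roots of `p`
  have hr₁ : p.IsRoot (finGammaTwo L v (σ T u s).1) := (hR T hT s hs _).2 ⟨u, rfl⟩
  have hr₂ : p.IsRoot (finGammaTwo L v (σ T u' s).1) := (hR T hT s hs _).2 ⟨u', rfl⟩
  have hne : finGammaTwo L v (σ T u s).1 ≠ finGammaTwo L v (σ T u' s).1 := hD T hT s hs u u' huu'
  obtain ⟨r₃, hp3⟩ := eq_prod_three_of_monic_of_isRoot_of_isRoot L v hns hpm hpdeg hr₁ hr₂ hne
  -- (3) the eigenvalue vector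
  set d : Fin 3 → UnitaryGroup.LocalRing L v := ![finGammaTwo L v (σ T u s).1, finGammaTwo L v (σ T u' s).1, r₃] with hd
  have hpd : p = ∏ k : Fin 3, (X - C (d k)) := by
    rw [hp3, Fin.prod_univ_three]
    simp only [hd, Matrix.cons_val_zero, Matrix.cons_val_one, Matrix.head_cons, Matrix.cons_val_two, Matrix.tail_cons]
  have hdi : Function.Injective d := by
    have h := hpsep
    rw [hpd] at h
    exact h.injective_of_prod_X_sub_C
  have hd1 : ∀ k, UnitaryGroup.conjLocal L (IsCMField.complexConj L) v (d k) * d k = 1 := by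
    intro k
    have hroot : p.IsRoot (d k) := by
      rw [hpd, IsRoot, eval_prod]
      exact Finset.prod_eq_zero (Finset.mem_univ k) (by rw [eval_sub, eval_X, eval_C, sub_self])
    obtain ⟨u₀, hu₀⟩ := (hR T hT s hs (d k)).1 hroot
    rw [← hu₀]
    exact conjLocal_finGammaTwo_mul_finGammaTwo L v (σ T u₀ s).1
  -- (4) the frame, over the field `E_v`
  letI : Field (UnitaryGroup.LocalRing L v) := hF.toField
  obtain ⟨P, hP⟩ := exists_eigenframe_of_charpoly_eq_prod (((eT T i₀ s : ↥(Subgroup.centralizer ({γc T i₀} : Set (Gqs L v)))) : Gqs L v).val) d hdi (hpb.trans hpd)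
  refine ⟨i₀, P, d, 0, 1, hP, hdi, hd1, ?_, ?_, by decide⟩
  · simp only [hd, Matrix.cons_val_zero]
  · simp only [hd, Matrix.cons_val_one, Matrix.cons_val_zero]

end CM

end Summit.HodgeConjecture.HodgeConjecture.Cruxes.H413.F0P3cStCharTSEllInnerFrameOfSlots

end
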